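import Literature.AnabelianGeometry.SemiGraphs.TemperedFixedSystemOfFiniteImages
import Literature.AnabelianGeometry.SemiGraphs.TemperedCompactInVerticialAtOfFixedSystems
import Literature.AnabelianGeometry.SemiGraphs.SubdivisionLemmas
import Literature.AnabelianGeometry.SemiGraphs.FreeGroupsAndActionsProofs2
import HarnessLib

/-!
# [SemiAnbd] Thm 3.7 (iii) beyond finite `𝔾`: the (FIX∞) pair from UNIFORM LEVEL-ESTRANGEMENT of the fixed loci

Mochizuki, *Semi-graphs of anabelioids*, Publ. RIMS **42** (2006), §3, Theorem 3.7 (iii), manuscript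
pp. 40–41, with the author's *Comments* (2020) (6)(b) [cite: MochizukiSemiAnbd2006, Thm 3.7(iii) pp.40-41]:
"suppose that (∗_j) fails to hold. Then for each `i ≥ j` … there exists a pair of distinct edges
`e_i, e'_i ∈ E_i` whose respective images `e_{j,i}, e'_{j,i} ∈ E_j` are distinct … a subjoint … this leads
to a contradiction, in light of our assumption that `G` is totally estranged."

PROOF-ONLY (cell abc-iut, layer L3, GAP row G-t6g3-2b «characterisation half», seat abc-iut-w6-d088, GO
α95; no definition, no new named fact).  Print's mechanism is isolated as a HYPOTHESIS on one compact
`C ≤ π₁^temp(𝒢)` over any `VerticialLevelData` — the binder (UE_C) «for every level `j` there is a level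
`k ≥ j` at which `C` fixes no two distinct edges at a common vertex of `𝒢_{∞,k}` whose images in `𝒢_{∞,j}`
are distinct» (what total estrangement gives at FINITE `𝔾`, uniformly over the finitely many vertices;
FALSE in general: the sliding-ray countermodels — abc-iut-L3-d1's `𝒢_θ`, kernel programme
SUBDAG-REFUTE-F1732, and the affine-group ray of this seat's memo `AFFINE-ESCAPE-WITNESS-and-UE.md` —
violate it maximally, the two branch images at the `k`-th vertex COINCIDING at level `n` for `k ≥ n`) —
and the full (FIX∞) pair of abc-iut-L3-t10's B1 (p427835) / abc-iut-w4-d083's B2 (p428299) is derived: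
* `SemiGraph.edgeMap_eq_along_path` / `…_path₀` — the FOLD: along a path of the barycentric subdivision
  all of whose nodes satisfy `P`, if any two distinct `P`-edges at a common vertex have the same image under
  a morphism `φ`, then ALL edges of the path have one `φ`-image and all its vertices map to its end-vertices;
* `VerticialLevelData.image_fixedLocus_finite_of_levelEstranged` — under (UE_C) at `(j,k)` the image in
  `𝒢_{∞,j}` of the `C`-fixed locus of `𝒢_{∞,k}` lies in the end-vertices of ONE edge, so is finite;
* `VerticialLevelData.hfix_of_uniformlyEstranged` (∘ abc-iut-w6-d066's `hfix_of_eventually_finite_images`,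
  p439369, whose weaker hypothesis «eventually finite images» is supplied), `hadj_of_uniformlyEstranged`,
  the pair `hfix_hadj_of_uniformlyEstranged`, and the closer `compactInVerticialAt_of_uniformlyEstranged`
  through B2 at the canonical tower.
Nothing here bears on [IUTchIII] Cor. 3.12.
-/

namespace Literature.AnabelianGeometry.SemiGraphs

open CategoryTheory

universe v u

namespace SemiGraph

variable (T T' : SemiGraph.{u}) (φ : T ⟶ T')

/-- The end-vertices of one edge form a finite set (an edge has exactly two branches, each abutting to
at most one vertex). [cite: MochizukiSemiAnbd2006, §1 p.11] -/
theorem finite_setOf_edgeAbuts (e : T.Edge) : {w : T.Vertex | T.EdgeAbuts e w}.Finite := by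
  obtain ⟨b₁, b₂, -, h₁, h₂, hall⟩ := T.two_branches e
  have hsub : {w : T.Vertex | T.EdgeAbuts e w} ⊆
      {w | T.abuts b₁ = some w} ∪ {w | T.abuts b₂ = some w} := by
    rintro w ⟨b, hb, hbw⟩
    rcases hall b hb with rfl | rfl
    · exact Or.inl hbw
    · exact Or.inr hbw
  refine Set.Finite.subset (Set.Finite.union ?_ ?_) hsub <;>
    refine Set.Subsingleton.finite fun w hw w' hw' => ?_ <;>
    exact Option.some_injective _ (hw.symm.trans hw')

/-- **The fold along a path.**  Let `φ : T → T'` be a morphism of semi-graphs and `P` a property of the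
nodes of the barycentric subdivision of `T` such that any two DISTINCT edges at a common vertex whose
edge-points satisfy `P` have the same image under `φ`.  Then along a PATH from the point of a vertex `u`
to the point of a vertex `y`, all of whose nodes satisfy `P`, and for a branch `b₀` at `u` whose edge
satisfies `P`: every edge of the path has the `φ`-image of the edge of `b₀`, and every vertex of the path
maps to an end-vertex of that image edge (induction on the length: the path leaves `u` through a branch,
its edge, the other branch, the next vertex — [SemiAnbd] Lem. 1.8 (ii) bookkeeping).
[cite: MochizukiSemiAnbd2006, Thm 3.7(iii) p.41] -/
theorem edgeMap_eq_along_path (P : T.Node → Prop)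
    (hH : ∀ (v : T.Vertex) (b b' : T.Branch), T.abuts b = some v → T.abuts b' = some v →
      T.edgeOf b ≠ T.edgeOf b' → P (Sum.inr (Sum.inl (T.edgeOf b))) →
      P (Sum.inr (Sum.inl (T.edgeOf b'))) → φ.edgeMap (T.edgeOf b) = φ.edgeMap (T.edgeOf b')) :
    ∀ (L : ℕ) {u y : T.Vertex} (p : T.subdivision.Walk (Sum.inl u) (Sum.inl y)), p.IsPath →
      p.length ≤ L → (∀ z ∈ p.support, P z) → ∀ (b₀ : T.Branch), T.abuts b₀ = some u →
      P (Sum.inr (Sum.inl (T.edgeOf b₀))) →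
      (∀ e : T.Edge, Sum.inr (Sum.inl e) ∈ p.support → φ.edgeMap e = φ.edgeMap (T.edgeOf b₀)) ∧
      (∀ w : T.Vertex, Sum.inl w ∈ p.support → T'.EdgeAbuts (φ.edgeMap (T.edgeOf b₀)) (φ.vertexMap w)) := by
  -- the conclusion for the trivial walk at `u`
  have hnil : ∀ (u : T.Vertex) (b₀ : T.Branch), T.abuts b₀ = some u →
      (∀ e : T.Edge, Sum.inr (Sum.inl e) ∈ (SimpleGraph.Walk.nil : T.subdivision.Walk (Sum.inl u) (Sum.inl u)).support →
        φ.edgeMap e = φ.edgeMap (T.edgeOf b₀)) ∧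
      (∀ w : T.Vertex, Sum.inl w ∈ (SimpleGraph.Walk.nil : T.subdivision.Walk (Sum.inl u) (Sum.inl u)).support →
        T'.EdgeAbuts (φ.edgeMap (T.edgeOf b₀)) (φ.vertexMap w)) := by
    intro u b₀ hb₀
    refine ⟨fun e he => ?_, fun w hw => ?_⟩
    · simp at he
    · simp only [SimpleGraph.Walk.support_nil, List.mem_singleton, Sum.inl.injEq] at hw
      subst hw
      exact ⟨φ.branchMap b₀, φ.edgeOf_branchMap b₀, φ.abuts_branchMap b₀ _ hb₀⟩
  intro L
  induction L with
  | zero =>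
    intro u y p _ hlen _ b₀ hb₀ _
    cases p with
    | nil => exact hnil u b₀ hb₀
    | cons h q => simp at hlen
  | succ L ih =>
    intro u y p hp hlen hP b₀ hb₀ hPb₀
    cases p with
    | nil => exact hnil u b₀ hb₀
    | cons h₁ p₁ =>
      rename_i z₁
      obtain ⟨b₁, hb₁u, rfl⟩ := (T.subdivision_adj_inl_iff u z₁).mp h₁
      rw [SimpleGraph.Walk.cons_isPath_iff] at hp
      obtain ⟨hp₁, hu_notMem⟩ := hp
      cases p₁ with
      | cons h₂ p₂ =>
        rename_i z₂
        rcases (T.subdivision_adj_branch_iff b₁ z₂).mp h₂ with rfl | ⟨v, hv, rfl⟩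
        · -- through the edge-point of `b₁`
          rw [SimpleGraph.Walk.cons_isPath_iff] at hp₁
          obtain ⟨hp₂, hb₁_notMem⟩ := hp₁
          cases p₂ with
          | cons h₃ p₃ =>
            rename_i z₃
            obtain ⟨b₃, hb₃e, rfl⟩ := (T.subdivision_adj_edge_iff (T.edgeOf b₁) z₃).mp h₃
            have hne : b₃ ≠ b₁ := by
              rintro rfl
              exact hb₁_notMem (by rw [SimpleGraph.Walk.support_cons]; exact List.mem_cons_of_mem _ p₃.start_mem_support)
            rw [SimpleGraph.Walk.cons_isPath_iff] at hp₂
            obtain ⟨hp₃, he_notMem⟩ := hp₂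
            cases p₃ with
            | cons h₄ p₄ =>
              rename_i z₄
              rcases (T.subdivision_adj_branch_iff b₃ z₄).mp h₄ with rfl | ⟨u₄, hu₄, rfl⟩
              · -- back to the edge-point: excluded on a path
                refine (he_notMem ?_).elim
                rw [SimpleGraph.Walk.support_cons, ← hb₃e]
                exact List.mem_cons_of_mem _ p₄.start_mem_support
              · -- arrived at the next vertex `u₄` across the edge `e₁ := edgeOf b₁ = edgeOf b₃`
                rw [SimpleGraph.Walk.cons_isPath_iff] at hp₃
                obtain ⟨hp₄, -⟩ := hp₃
                have hlen₄ : p₄.length ≤ L := by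
                  simp only [SimpleGraph.Walk.length_cons] at hlen
                  omega
                have hPe : P (Sum.inr (Sum.inl (T.edgeOf b₁))) := by
                  refine hP _ ?_
                  rw [SimpleGraph.Walk.support_cons, SimpleGraph.Walk.support_cons]
                  exact List.mem_cons_of_mem _ (List.mem_cons_of_mem _ (SimpleGraph.Walk.start_mem_support _))
                have hP₄ : ∀ z ∈ p₄.support, P z := fun z hz => hP _ (by
                  simp only [SimpleGraph.Walk.support_cons, List.mem_cons]
                  exact Or.inr (Or.inr (Or.inr (Or.inr hz))))
                -- the first edge has the image of the edge of `b₀` (equal, or `hH` at `u`)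
                have he₁ : φ.edgeMap (T.edgeOf b₁) = φ.edgeMap (T.edgeOf b₀) := by
                  by_cases heq : T.edgeOf b₁ = T.edgeOf b₀
                  · rw [heq]
                  · exact hH u b₁ b₀ hb₁u hb₀ heq hPe hPb₀
                -- induction hypothesis from `u₄`, entered through `b₃`
                have hPe₃ : P (Sum.inr (Sum.inl (T.edgeOf b₃))) := by rw [hb₃e]; exact hPe
                obtain ⟨ihE, ihV⟩ := ih p₄ hp₄ hlen₄ hP₄ b₃ hu₄ hPe₃
                rw [hb₃e, he₁] at ihE ihV
                refine ⟨fun e he => ?_, fun w hw => ?_⟩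
                · simp only [SimpleGraph.Walk.support_cons, List.mem_cons, Sum.inr.injEq,
                    Sum.inl.injEq, reduceCtorEq, false_or] at he
                  rcases he with rfl | he
                  · exact he₁
                  · exact ihE e he
                · simp only [SimpleGraph.Walk.support_cons, List.mem_cons, Sum.inl.injEq,
                    reduceCtorEq, false_or] at hw
                  rcases hw with rfl | hw
                  · exact ⟨φ.branchMap b₀, φ.edgeOf_branchMap b₀, φ.abuts_branchMap b₀ _ hb₀⟩
                  · exact ihV w hw
        · -- back to the vertex `u`: excluded on a path
          rw [hb₁u] at hv; cases hv
          exact (hu_notMem (by rw [SimpleGraph.Walk.support_cons]; exact List.mem_cons_of_mem _ p₂.start_mem_support)).elim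

/-- The fold along a path between two DISTINCT vertices, without a prescribed initial branch: the path's
own first edge serves (it leaves `u` through a branch `b₁` and the edge-point of `b₁`).
[cite: MochizukiSemiAnbd2006, Thm 3.7(iii) p.41] -/
theorem edgeMap_eq_along_path₀ (P : T.Node → Prop)
    (hH : ∀ (v : T.Vertex) (b b' : T.Branch), T.abuts b = some v → T.abuts b' = some v →
      T.edgeOf b ≠ T.edgeOf b' → P (Sum.inr (Sum.inl (T.edgeOf b))) →
      P (Sum.inr (Sum.inl (T.edgeOf b'))) → φ.edgeMap (T.edgeOf b) = φ.edgeMap (T.edgeOf b'))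
    {u y : T.Vertex} (huy : u ≠ y) (p : T.subdivision.Walk (Sum.inl u) (Sum.inl y)) (hp : p.IsPath)
    (hP : ∀ z ∈ p.support, P z) :
    ∃ b₁ : T.Branch, T.abuts b₁ = some u ∧ P (Sum.inr (Sum.inl (T.edgeOf b₁))) ∧
      (∀ e : T.Edge, Sum.inr (Sum.inl e) ∈ p.support → φ.edgeMap e = φ.edgeMap (T.edgeOf b₁)) ∧
      (∀ w : T.Vertex, Sum.inl w ∈ p.support → T'.EdgeAbuts (φ.edgeMap (T.edgeOf b₁)) (φ.vertexMap w)) := by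
  have hp' := hp
  cases p with
  | nil => exact absurd rfl huy
  | cons h₁ p₁ =>
    rename_i z₁
    obtain ⟨b₁, hb₁u, rfl⟩ := (T.subdivision_adj_inl_iff u z₁).mp h₁
    rw [SimpleGraph.Walk.cons_isPath_iff] at hp
    obtain ⟨hp₁, hu_notMem⟩ := hp
    cases p₁ with
    | cons h₂ p₂ =>
      rename_i z₂
      rcases (T.subdivision_adj_branch_iff b₁ z₂).mp h₂ with rfl | ⟨v, hv, rfl⟩
      · have hPe : P (Sum.inr (Sum.inl (T.edgeOf b₁))) := by
          apply hP
          rw [SimpleGraph.Walk.support_cons, SimpleGraph.Walk.support_cons]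
          exact List.mem_cons_of_mem _ (List.mem_cons_of_mem _ (SimpleGraph.Walk.start_mem_support _))
        exact ⟨b₁, hb₁u, hPe, T.edgeMap_eq_along_path T' φ P hH _ _ hp' le_rfl hP b₁ hb₁u hPe⟩
      · rw [hb₁u] at hv; cases hv
        exact (hu_notMem (by rw [SimpleGraph.Walk.support_cons]; exact List.mem_cons_of_mem _ p₂.start_mem_support)).elim

end SemiGraph

/-! ### Consequences over a `VerticialLevelData` -/

namespace ProfiniteSemiGraph

namespace VerticialLevelData

variable {𝒢 : ProfiniteSemiGraph.{u}} {c : TemperedPiChart 𝒢} (D : VerticialLevelData.{v} 𝒢 c)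

/-- Under the level-estrangement hypothesis at `(j, k)` («`C` fixes no two distinct edges at a common vertex
of `𝒢_{∞,k}` with distinct images in `𝒢_{∞,j}`»), for `C`-fixed vertices `x ≠ x'` of `𝒢_{∞,k}` the image
of `x'` is an END-VERTEX of the image of the first edge of the `C`-fixed geodesic from `x` to `x'` ([SemiAnbd]
Lem. 1.8 (ii)(b): the geodesic is fixed; then the fold). [cite: MochizukiSemiAnbd2006, Thm 3.7(iii) p.41] -/
theorem exists_fixed_edge_images_abut_of_levelEstranged (C : Subgroup c.G) ⦃j k : D.J⦄ (hjk : j ≤ k)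
    (hUE : ∀ (v : (D.tree k).Vertex) (b b' : (D.tree k).Branch), (D.tree k).abuts b = some v →
      (D.tree k).abuts b' = some v → (D.tree k).edgeOf b ≠ (D.tree k).edgeOf b' →
      (∀ g ∈ C, (D.act k g).hom.edgeMap ((D.tree k).edgeOf b) = (D.tree k).edgeOf b) →
      (∀ g ∈ C, (D.act k g).hom.edgeMap ((D.tree k).edgeOf b') = (D.tree k).edgeOf b') →
      (D.trans hjk).edgeMap ((D.tree k).edgeOf b) = (D.trans hjk).edgeMap ((D.tree k).edgeOf b'))
    {x x' : (D.tree k).Vertex} (hxx' : x ≠ x') (hx : ∀ g ∈ C, (D.act k g).hom.vertexMap x = x)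
    (hx' : ∀ g ∈ C, (D.act k g).hom.vertexMap x' = x') :
    ∃ b₁ : (D.tree k).Branch, (D.tree k).abuts b₁ = some x ∧
      (∀ g ∈ C, (D.act k g).hom.edgeMap ((D.tree k).edgeOf b₁) = (D.tree k).edgeOf b₁) ∧
      (D.tree j).EdgeAbuts ((D.trans hjk).edgeMap ((D.tree k).edgeOf b₁)) ((D.trans hjk).vertexMap x') := by
  classical
  have hT := (D.isTree k).isTree
  -- the fixed geodesic
  let p : (D.tree k).subdivision.Path (Sum.inl x) (Sum.inl x') :=
    (hT.connected (Sum.inl x) (Sum.inl x')).some.toPath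
  let P : (D.tree k).Node → Prop := fun z => ∀ g ∈ C, SemiGraph.nodeMap (D.act k g) z = z
  have hall : ∀ z ∈ p.1.support, P z := by
    intro z hz g hg
    have hxn : SemiGraph.nodeMap (D.act k g) (Sum.inl x) = Sum.inl x := by simp [hx g hg]
    have hx'n : SemiGraph.nodeMap (D.act k g) (Sum.inl x') = Sum.inl x' := by simp [hx' g hg]
    exact SemiGraph.nodeMap_eq_self_of_isPath hT.isAcyclic _ hxn hx'n p.1 p.2 z hz
  -- `P` at an edge-point is `C`-fixedness of the edge
  have hPE : ∀ e : (D.tree k).Edge, P (Sum.inr (Sum.inl e)) ↔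
      ∀ g ∈ C, (D.act k g).hom.edgeMap e = e := by
    intro e
    exact ⟨fun h g hg => by simpa using h g hg, fun h g hg => by simp [h g hg]⟩
  have hH : ∀ (v : (D.tree k).Vertex) (b b' : (D.tree k).Branch), (D.tree k).abuts b = some v →
      (D.tree k).abuts b' = some v → (D.tree k).edgeOf b ≠ (D.tree k).edgeOf b' →
      P (Sum.inr (Sum.inl ((D.tree k).edgeOf b))) → P (Sum.inr (Sum.inl ((D.tree k).edgeOf b'))) →
      (D.trans hjk).edgeMap ((D.tree k).edgeOf b) = (D.trans hjk).edgeMap ((D.tree k).edgeOf b') :=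
    fun v b b' hb hb' hne hPb hPb' => hUE v b b' hb hb' hne ((hPE _).mp hPb) ((hPE _).mp hPb')
  obtain ⟨b₁, hb₁, hPb₁, -, hV⟩ :=
    (D.tree k).edgeMap_eq_along_path₀ (D.tree j) (D.trans hjk) P hH hxx' p.1 p.2 hall
  exact ⟨b₁, hb₁, (hPE _).mp hPb₁, hV x' p.1.end_mem_support⟩

/-- **Finite images under level-estrangement** (print's (∗_j) mechanism): under the level-estrangement
hypothesis at `(j, k)` the image in `𝒢_{∞,j}` of the `C`-fixed locus of `𝒢_{∞,k}` is contained in the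
end-vertices of one edge (or is a subsingleton), hence FINITE — the hypothesis of abc-iut-w6-d066's
`hfix_of_eventually_finite_images`. [cite: MochizukiSemiAnbd2006, Thm 3.7(iii) p.41] -/
theorem image_fixedLocus_finite_of_levelEstranged (C : Subgroup c.G) ⦃j k : D.J⦄ (hjk : j ≤ k)
    (hUE : ∀ (v : (D.tree k).Vertex) (b b' : (D.tree k).Branch), (D.tree k).abuts b = some v →
      (D.tree k).abuts b' = some v → (D.tree k).edgeOf b ≠ (D.tree k).edgeOf b' →
      (∀ g ∈ C, (D.act k g).hom.edgeMap ((D.tree k).edgeOf b) = (D.tree k).edgeOf b) →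
      (∀ g ∈ C, (D.act k g).hom.edgeMap ((D.tree k).edgeOf b') = (D.tree k).edgeOf b') →
      (D.trans hjk).edgeMap ((D.tree k).edgeOf b) = (D.trans hjk).edgeMap ((D.tree k).edgeOf b')) :
    ((D.trans hjk).vertexMap ''
      {x : (D.tree k).Vertex | ∀ g ∈ C, (D.act k g).hom.vertexMap x = x}).Finite := by
  classical
  set Fix : Set (D.tree k).Vertex := {x | ∀ g ∈ C, (D.act k g).hom.vertexMap x = x} with hFix
  by_cases hsub : Fix.Subsingleton
  · exact (hsub.image _).finite
  -- two distinct fixed vertices `x₀ ≠ x₁`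
  obtain ⟨x₀, hx₀, x₁, hx₁, h01⟩ : ∃ x₀ ∈ Fix, ∃ x₁ ∈ Fix, x₀ ≠ x₁ := by
    by_contra h
    push Not at h
    exact hsub fun a ha b hb => h a ha b hb
  -- the first edge `ε₁` of the fixed geodesic from `x₀` to `x₁`; every fixed vertex maps to an end of its image
  obtain ⟨b₁, hb₁, hfixb₁, -⟩ := D.exists_fixed_edge_images_abut_of_levelEstranged C hjk hUE h01 hx₀ hx₁
  refine ((D.tree j).finite_setOf_edgeAbuts ((D.trans hjk).edgeMap ((D.tree k).edgeOf b₁))).subset ?_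
  rintro _ ⟨x, hx, rfl⟩
  by_cases hx0 : x₀ = x
  · -- `x = x₀` abuts `ε₁` itself
    subst hx0
    exact ⟨(D.trans hjk).branchMap b₁, (D.trans hjk).edgeOf_branchMap b₁,
      (D.trans hjk).abuts_branchMap b₁ _ hb₁⟩
  · -- `x ≠ x₀`: the first edge `ε` of the fixed geodesic from `x₀` to `x` has the same image as `ε₁`
    obtain ⟨b, hb, hfixb, habut⟩ := D.exists_fixed_edge_images_abut_of_levelEstranged C hjk hUE hx0 hx₀ hx
    by_cases hbb : (D.tree k).edgeOf b = (D.tree k).edgeOf b₁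
    · rw [← hbb]; exact habut
    · rw [← hUE x₀ b b₁ hb hb₁ hbb hfixb hfixb₁]; exact habut

/-- **`hfix` from uniform level-estrangement**: if `C ≤ π₁^temp(𝒢)` is compact and for every level `j`
there is a level `k ≥ j` at which `C` fixes no two distinct edges at a common vertex of `𝒢_{∞,k}` with
distinct images in `𝒢_{∞,j}` (UE_C), then `C` fixes a compatible system of vertices of the trees — the
clause `hfix` of (FIX∞) (∘ abc-iut-w6-d066's `hfix_of_eventually_finite_images`, whose weaker
hypothesis «eventually finite images» this file supplies). [cite: MochizukiSemiAnbd2006, Thm 3.7(iii) p.41] -/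
theorem hfix_of_uniformlyEstranged (C : Subgroup c.G) (hC : IsCompact (C : Set c.G))
    (hUE : ∀ j : D.J, ∃ (k : D.J) (hjk : j ≤ k),
      ∀ (v : (D.tree k).Vertex) (b b' : (D.tree k).Branch), (D.tree k).abuts b = some v →
      (D.tree k).abuts b' = some v → (D.tree k).edgeOf b ≠ (D.tree k).edgeOf b' →
      (∀ g ∈ C, (D.act k g).hom.edgeMap ((D.tree k).edgeOf b) = (D.tree k).edgeOf b) →
      (∀ g ∈ C, (D.act k g).hom.edgeMap ((D.tree k).edgeOf b') = (D.tree k).edgeOf b') →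
      (D.trans hjk).edgeMap ((D.tree k).edgeOf b) = (D.trans hjk).edgeMap ((D.tree k).edgeOf b')) :
    ∃ x : ∀ j, (D.tree j).Vertex, (∀ ⦃i j : D.J⦄ (h : i ≤ j), (D.trans h).vertexMap (x j) = x i) ∧
      ∀ g ∈ C, ∀ j, (D.act j g).hom.vertexMap (x j) = x j :=
  D.hfix_of_eventually_finite_images C hC fun j => by
    obtain ⟨k, hjk, h⟩ := hUE j
    exact ⟨k, hjk, D.image_fixedLocus_finite_of_levelEstranged C hjk h⟩

/-- **`hadj` from uniform level-estrangement**: under (UE_C), two compatible `C`-fixed vertex systems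
are, at every level where they differ, the two end-vertices of a `C`-fixed edge — the adjacency clause of
(FIX∞) (print: "if `H` fixes two vertices of `𝒢_{∞,j}`, then these two vertices are joined to one another
by a single [closed] edge", p. 41, for COMPATIBLE systems).  At the level `k ≥ j` of (UE_C) the two values
are distinct `C`-fixed vertices, and the fold sends them to the two ends of the image of the first edge of
the fixed geodesic joining them. [cite: MochizukiSemiAnbd2006, Thm 3.7(iii) p.41] -/
theorem hadj_of_uniformlyEstranged (C : Subgroup c.G)
    (hUE : ∀ j : D.J, ∃ (k : D.J) (hjk : j ≤ k),
      ∀ (v : (D.tree k).Vertex) (b b' : (D.tree k).Branch), (D.tree k).abuts b = some v →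
      (D.tree k).abuts b' = some v → (D.tree k).edgeOf b ≠ (D.tree k).edgeOf b' →
      (∀ g ∈ C, (D.act k g).hom.edgeMap ((D.tree k).edgeOf b) = (D.tree k).edgeOf b) →
      (∀ g ∈ C, (D.act k g).hom.edgeMap ((D.tree k).edgeOf b') = (D.tree k).edgeOf b') →
      (D.trans hjk).edgeMap ((D.tree k).edgeOf b) = (D.trans hjk).edgeMap ((D.tree k).edgeOf b'))
    (x x' : ∀ j, (D.tree j).Vertex)
    (hx : ∀ ⦃i j : D.J⦄ (h : i ≤ j), (D.trans h).vertexMap (x j) = x i)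
    (hx' : ∀ ⦃i j : D.J⦄ (h : i ≤ j), (D.trans h).vertexMap (x' j) = x' i)
    (hfx : ∀ g ∈ C, ∀ j, (D.act j g).hom.vertexMap (x j) = x j)
    (hfx' : ∀ g ∈ C, ∀ j, (D.act j g).hom.vertexMap (x' j) = x' j) :
    ∀ j, x j ≠ x' j → ∃ (e : (D.tree j).Edge) (b b' : (D.tree j).Branch), b ≠ b' ∧
      (D.tree j).edgeOf b = e ∧ (D.tree j).edgeOf b' = e ∧ (D.tree j).abuts b = some (x j) ∧
      (D.tree j).abuts b' = some (x' j) ∧ ∀ g ∈ C, (D.act j g).hom.edgeMap e = e := by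
  intro j hne
  obtain ⟨k, hjk, hUEk⟩ := hUE j
  have hnek : x k ≠ x' k := fun h => hne (by rw [← hx hjk, ← hx' hjk, h])
  obtain ⟨b₁, hb₁, hfixb₁, habut⟩ := D.exists_fixed_edge_images_abut_of_levelEstranged C hjk hUEk hnek
    (fun g hg => hfx g hg k) (fun g hg => hfx' g hg k)
  rw [hx' hjk] at habut
  obtain ⟨b', hb'e, hb'x'⟩ := habut
  refine ⟨(D.trans hjk).edgeMap ((D.tree k).edgeOf b₁), (D.trans hjk).branchMap b₁, b', ?_,
    (D.trans hjk).edgeOf_branchMap b₁, hb'e, ?_, hb'x', fun g hg => ?_⟩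
  · rintro rfl
    have h := ((D.trans hjk).abuts_branchMap b₁ _ hb₁).symm.trans hb'x'
    rw [hx hjk] at h
    exact hne (Option.some_injective _ h)
  · rw [← hx hjk]; exact (D.trans hjk).abuts_branchMap b₁ _ hb₁
  · rw [← D.trans_act_edgeMap hjk g, hfixb₁ g hg]

/-- **(FIX∞) from uniform level-estrangement** — both clauses packaged for one compact `C`.
[cite: MochizukiSemiAnbd2006, Thm 3.7(iii) p.41] -/
theorem hfix_hadj_of_uniformlyEstranged (C : Subgroup c.G) (hC : IsCompact (C : Set c.G))
    (hUE : ∀ j : D.J, ∃ (k : D.J) (hjk : j ≤ k),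
      ∀ (v : (D.tree k).Vertex) (b b' : (D.tree k).Branch), (D.tree k).abuts b = some v →
      (D.tree k).abuts b' = some v → (D.tree k).edgeOf b ≠ (D.tree k).edgeOf b' →
      (∀ g ∈ C, (D.act k g).hom.edgeMap ((D.tree k).edgeOf b) = (D.tree k).edgeOf b) →
      (∀ g ∈ C, (D.act k g).hom.edgeMap ((D.tree k).edgeOf b') = (D.tree k).edgeOf b') →
      (D.trans hjk).edgeMap ((D.tree k).edgeOf b) = (D.trans hjk).edgeMap ((D.tree k).edgeOf b')) :
    (∃ x : ∀ j, (D.tree j).Vertex, (∀ ⦃i j : D.J⦄ (h : i ≤ j), (D.trans h).vertexMap (x j) = x i) ∧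
      ∀ g ∈ C, ∀ j, (D.act j g).hom.vertexMap (x j) = x j) ∧
    ∀ x x' : ∀ j, (D.tree j).Vertex,
      (∀ ⦃i j : D.J⦄ (h : i ≤ j), (D.trans h).vertexMap (x j) = x i) →
      (∀ ⦃i j : D.J⦄ (h : i ≤ j), (D.trans h).vertexMap (x' j) = x' i) →
      (∀ g ∈ C, ∀ j, (D.act j g).hom.vertexMap (x j) = x j) →
      (∀ g ∈ C, ∀ j, (D.act j g).hom.vertexMap (x' j) = x' j) →
      ∀ j, x j ≠ x' j → ∃ (e : (D.tree j).Edge) (b b' : (D.tree j).Branch), b ≠ b' ∧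
        (D.tree j).edgeOf b = e ∧ (D.tree j).edgeOf b' = e ∧ (D.tree j).abuts b = some (x j) ∧
        (D.tree j).abuts b' = some (x' j) ∧ ∀ g ∈ C, (D.act j g).hom.edgeMap e = e :=
  ⟨D.hfix_of_uniformlyEstranged C hC hUE, D.hadj_of_uniformlyEstranged C hUE⟩

end VerticialLevelData

variable {𝒢 : ProfiniteSemiGraph.{u}} in
/-- **`CompactInVerticialAt 𝒢` modulo uniform level-estrangement at the canonical tower** (∘
abc-iut-w4-d083's B2 `compactInVerticialAt_of_fixedSystems`, p428299): for `𝒢` satisfying the hypotheses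
of Prop. 3.6, if every nontrivial compact subgroup of `π₁^temp(𝒢)` is uniformly level-estranged along
the canonical Galois tower `verticialLevelData_temperedPiChart h36` (UE_C), then Thm. 3.7 (iii) holds AT
`𝒢`.  TRUE at finite `𝔾` (where the At-form is already the theorem p431007); the binder is FALSE in
general (sliding-ray countermodels). [cite: MochizukiSemiAnbd2006, Thm 3.7(iii) pp.40-41] -/
theorem compactInVerticialAt_of_uniformlyEstranged (h36 : 𝒢.Prop36Hypotheses)
    (hUE : ∀ C : Subgroup (𝒢.temperedPiChart h36).G, IsCompact (C : Set (𝒢.temperedPiChart h36).G) →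
      C ≠ ⊥ → ∀ j : (verticialLevelData_temperedPiChart (h36 := h36)).J,
      ∃ (k : (verticialLevelData_temperedPiChart (h36 := h36)).J) (hjk : j ≤ k),
      ∀ (v : ((verticialLevelData_temperedPiChart (h36 := h36)).tree k).Vertex)
        (b b' : ((verticialLevelData_temperedPiChart (h36 := h36)).tree k).Branch),
        ((verticialLevelData_temperedPiChart (h36 := h36)).tree k).abuts b = some v →
        ((verticialLevelData_temperedPiChart (h36 := h36)).tree k).abuts b' = some v →
        ((verticialLevelData_temperedPiChart (h36 := h36)).tree k).edgeOf b ≠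
          ((verticialLevelData_temperedPiChart (h36 := h36)).tree k).edgeOf b' →
        (∀ g ∈ C, ((verticialLevelData_temperedPiChart (h36 := h36)).act k g).hom.edgeMap
          (((verticialLevelData_temperedPiChart (h36 := h36)).tree k).edgeOf b) =
          ((verticialLevelData_temperedPiChart (h36 := h36)).tree k).edgeOf b) →
        (∀ g ∈ C, ((verticialLevelData_temperedPiChart (h36 := h36)).act k g).hom.edgeMap
          (((verticialLevelData_temperedPiChart (h36 := h36)).tree k).edgeOf b') =
          ((verticialLevelData_temperedPiChart (h36 := h36)).tree k).edgeOf b') →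
        ((verticialLevelData_temperedPiChart (h36 := h36)).trans hjk).edgeMap
            (((verticialLevelData_temperedPiChart (h36 := h36)).tree k).edgeOf b) =
          ((verticialLevelData_temperedPiChart (h36 := h36)).trans hjk).edgeMap
            (((verticialLevelData_temperedPiChart (h36 := h36)).tree k).edgeOf b')) :
    CompactInVerticialAt 𝒢 :=
  compactInVerticialAt_of_fixedSystems h36
    (fun C hC hne => (verticialLevelData_temperedPiChart (h36 := h36)).hfix_of_uniformlyEstranged C hC
      (hUE C hC hne))
    (fun C hC hne => (verticialLevelData_temperedPiChart (h36 := h36)).hadj_of_uniformlyEstranged C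
      (hUE C hC hne))

end ProfiniteSemiGraph

end Literature.AnabelianGeometry.SemiGraphs
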